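import Literature.NumberTheory.GaloisRepresentations.SymplecticMultiplier
import Literature.NumberTheory.GaloisRepresentations.LocalGaloisGroup
import Literature.NumberTheory.Automorphic.AdicCompletionLocalField
import HarnessLib

/-!
# Ordinary symplectic representations: the quotient block is the twisted contragredient of the
# sub block (Siegel-parabolic elements of `GSp₄`)

Topic `NumberTheory/GaloisRepresentations`; a `…Proofs` file (theorems only: no definition, no
named fact, no `sorry`), companion of `SymplecticMultiplier`, landed by the seat of the named fact
`Literature.NumberTheory.DiophantineGeometry.bcgp_switch_exists_modular_abelianSurface`
(Boxer–Calegari–Gee–Pilloni, arXiv:2502.20645, Lemma 9.4.2) to record, as theorems, the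
linear algebra behind the way that fact (and the Langlands route `PhantomRMYoshida`,
`IsOrdinaryFlatAt`) renders the printed hypothesis

> "`ρ̄^∨|_{G_{ℚ₃}}` is ordinary, so it is an extension of an unramified 2-dimensional
> representation `V̄` by its Cartier dual" (loc. cit. Cor. 9.3.5; Def. 1.8.8)

by a FRAME condition: `ρ̄ : Γ → GSp₄` (symplectic with multiplier `ν = ε̄⁻¹`) is block
upper-triangular in some frame, with inertia acting trivially on the rank-2 sub and through the
scalar `ν` on the rank-2 quotient.  The two formulations agree because of two facts about the
Siegel parabolic of `GSp_{2k}` proved here for block matrices over any commutative ring: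

* `fromBlocks_topLeft_eq_zero_of_fixed` — if `M = (1 B; 0 D)` satisfies `Mᵀ J M = ν J` with
  `ν ≠ 1` (no zero divisors), the Gram matrix `J` vanishes on the fixed sub-block: the subspace
  fixed pointwise by an element of `GSp(J)` of multiplier `≠ 1` is ISOTROPIC (for the sub of an
  ordinary `ρ̄` at `p`: some inertia element has `ε̄⁻¹ ≠ 1`, so the unramified sub is Lagrangian);
* `fromBlocks_blocks_eq_of_symplectic_blockTriangular` and
  `lowerRight_eq_smul_conj_of_symplectic_blockTriangular` — if `J = (0 Q; P T)` vanishes on the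
  sub-block and `M = (A B; 0 D) ∈ GSp(J)` has multiplier `ν`, then `Aᵀ Q D = ν Q`, i.e.
  `D = ν · Q⁻¹ (A⁻¹)ᵀ Q`: the quotient block is the `ν`-twist of the contragredient of the sub
  block, conjugated by the FIXED matrix `Q⁻¹` (the Levi of the Siegel parabolic is
  `{(A, ν A⁻ᵀ)}`); `isUnit_det_blocks_of_fromBlocks_zero₁₁` supplies `Q` invertible from `det J`
  a unit.

They are transported to `4 × 4` matrices cut at `2` (the convention `(i : ℕ) < 2` / `2 ≤ (i : ℕ)`
of the tree's statements) in
`quotientBlock_eq_of_symplectic_blockUpperTriangular`, and to framed Galois representations in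
the exact shape of the hypotheses of `bcgp_switch_exists_modular_abelianSurface` /
`IsOrdinaryFlatAt` (a conjugating frame `g`, the local representation `ρ.toLocal v`, inertia
`absInertia (K_v)`) in
`FramedGaloisRep.IsSymplecticWithMultiplierFun.quotientBlock_toLocal_eq_smul_conj`: the quotient
`2 × 2` block of `g ρ|_{Γ_{K_v}} g⁻¹` is `ν · Q⁻¹ (sub block)⁻ᵀ Q` for a fixed invertible `Q`, and the
transported Gram matrix vanishes on the sub — which is the statement "`ρ̄|_{Γ_{K_v}}` is an
extension of `W^∨ ⊗ ν` by the unramified `W`", equivalently (dualising, `ν = ε̄⁻¹`) "`ρ̄^∨` is an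
extension of the unramified `V̄ = W^∨` by its Cartier dual `V̄^∨(1)`", as printed.

## References

* [BoxerCalegariGeePilloni2025] G. Boxer, F. Calegari, T. Gee, V. Pilloni, *Modularity theorems
  for abelian surfaces*, arXiv:2502.20645: Def. 1.8.8, Cor. 9.3.5, Lemma 9.4.2.
* [BoxerEtAl2021] G. Boxer, F. Calegari, T. Gee, V. Pilloni, *Abelian surfaces over totally real
  fields are potentially modular*, Publ. IHÉS 134 (2021), §2 (`GSp₄`, similitude, Siegel parabolic).

## Design

Pure theorems; block algebra stated with Mathlib's `Matrix.fromBlocks` over a commutative ring,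
the `Fin 4` statements with `Matrix.submatrix (Fin.castAdd 2 / Fin.natAdd 2)` for the blocks (no
new definition); axioms `propext`, `Classical.choice`, `Quot.sound`.
-/

namespace Literature.NumberTheory.GaloisRepresentations

open Matrix Field IsDedekindDomain
open scoped NumberField

universe u v

/-! ## Block algebra: elements of `GSp(J)` stabilising an isotropic half -/

section BlockAlgebra

variable {R : Type*} [CommRing R] {m : Type*} [Fintype m] [DecidableEq m]

/-- **The fixed subspace of an element of `GSp(J)` with multiplier `ν ≠ 1` is isotropic.**  If
`M = (1 B; 0 D)` satisfies `Mᵀ J M = ν • J` for `J = (S Q; P T)` and `ν ≠ 1` (no zero divisors),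
then `S = 0`: indeed the top-left block of `Mᵀ J M` is `S`, so `S = ν S`. [folklore] -/
theorem fromBlocks_topLeft_eq_zero_of_fixed [NoZeroDivisors R] {S Q P T B D : Matrix m m R}
    {ν : R} (hν : ν ≠ 1)
    (h : (fromBlocks 1 B 0 D)ᵀ * fromBlocks S Q P T * fromBlocks 1 B 0 D =
      ν • fromBlocks S Q P T) :
    S = 0 := by
  rw [fromBlocks_transpose, transpose_one, transpose_zero, fromBlocks_multiply,
    fromBlocks_multiply, fromBlocks_smul, fromBlocks_inj] at h
  obtain ⟨h11, -, -, -⟩ := h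
  simp only [Matrix.mul_one, Matrix.mul_zero, add_zero, Matrix.one_mul, Matrix.zero_mul] at h11
  ext i j
  have hij : S i j = ν * S i j := by
    have h := congrFun (congrFun h11 i) j
    rwa [Matrix.smul_apply, smul_eq_mul] at h
  have h0 : (1 - ν) * S i j = 0 := by rw [sub_mul, one_mul, ← hij, sub_self]
  rcases mul_eq_zero.mp h0 with h1 | h1
  · exact absurd (sub_eq_zero.mp h1).symm hν
  · rw [h1, Matrix.zero_apply]

omit [DecidableEq m] in
/-- **Block relations for a block-upper-triangular element of `GSp(J)`, `J` vanishing on the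
sub-block.**  If `J = (0 Q; P T)` and `M = (A B; 0 D)` satisfies `Mᵀ J M = ν • J`, then
`Aᵀ Q D = ν Q` and `Dᵀ P A = ν P` (the off-diagonal blocks of `Mᵀ J M`). [folklore] -/
theorem fromBlocks_blocks_eq_of_symplectic_blockTriangular {Q P T A B D : Matrix m m R} {ν : R}
    (h : (fromBlocks A B 0 D)ᵀ * fromBlocks 0 Q P T * fromBlocks A B 0 D =
      ν • fromBlocks 0 Q P T) :
    Aᵀ * Q * D = ν • Q ∧ Dᵀ * P * A = ν • P := by
  rw [fromBlocks_transpose, transpose_zero, fromBlocks_multiply, fromBlocks_multiply,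
    fromBlocks_smul, fromBlocks_inj] at h
  obtain ⟨-, h12, h21, -⟩ := h
  simp only [Matrix.mul_zero, Matrix.zero_mul, zero_add, add_zero] at h12 h21
  exact ⟨h12, h21⟩

/-- **The quotient block is the `ν`-twisted contragredient of the sub block, up to the fixed
conjugator `Q⁻¹`:** from `Aᵀ Q D = ν Q` with `A`, `Q` invertible, `D = ν • (Q⁻¹ (A⁻¹)ᵀ Q)` (the
Levi factor of the Siegel parabolic of `GSp_{2k}` is `{(A, ν A⁻ᵀ)}`). [folklore] -/
theorem lowerRight_eq_smul_conj_transpose_inv {Q A D : Matrix m m R} {ν : R}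
    (hA : IsUnit A.det) (hQ : IsUnit Q.det) (h : Aᵀ * Q * D = ν • Q) :
    D = ν • (Q⁻¹ * (A⁻¹)ᵀ * Q) := by
  have hAt : IsUnit Aᵀ.det := by rwa [det_transpose]
  have hAQ : IsUnit (Aᵀ * Q).det := by
    rw [det_mul]
    exact hAt.mul hQ
  calc D = (Aᵀ * Q)⁻¹ * (Aᵀ * Q * D) := by
        rw [← Matrix.mul_assoc, nonsing_inv_mul _ hAQ, Matrix.one_mul]
    _ = ν • (Q⁻¹ * (A⁻¹)ᵀ * Q) := by
        rw [h, Matrix.mul_smul, Matrix.mul_inv_rev, transpose_nonsing_inv]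

/-- Combination of the two previous lemmas: for `J = (0 Q; P T)` with `Q` invertible and
`M = (A B; 0 D) ∈ GSp(J)` of multiplier `ν` with `A` invertible, `D = ν • (Q⁻¹ (A⁻¹)ᵀ Q)`. [folklore] -/
theorem lowerRight_eq_smul_conj_of_symplectic_blockTriangular {Q P T A B D : Matrix m m R} {ν : R}
    (hA : IsUnit A.det) (hQ : IsUnit Q.det)
    (h : (fromBlocks A B 0 D)ᵀ * fromBlocks 0 Q P T * fromBlocks A B 0 D =
      ν • fromBlocks 0 Q P T) :
    D = ν • (Q⁻¹ * (A⁻¹)ᵀ * Q) :=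
  lowerRight_eq_smul_conj_transpose_inv hA hQ
    (fromBlocks_blocks_eq_of_symplectic_blockTriangular h).1

/-- If `J = (0 Q; P T)` (zero sub-block) has unit determinant then `Q` and `P` have unit
determinants (`det J = ± det Q · det P`: swap the two block columns, Mathlib
`Matrix.det_permute'`, `Matrix.det_fromBlocks_zero₁₂`). [folklore] -/
theorem isUnit_det_blocks_of_fromBlocks_zero₁₁ {Q P T : Matrix m m R}
    (h : IsUnit (fromBlocks (0 : Matrix m m R) Q P T).det) : IsUnit Q.det ∧ IsUnit P.det := by
  have hperm := det_permute' (Equiv.sumComm m m) (fromBlocks (0 : Matrix m m R) Q P T)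
  have hswap : (fromBlocks (0 : Matrix m m R) Q P T).submatrix id (Equiv.sumComm m m) =
      fromBlocks Q 0 T P := by
    ext i j
    rcases i with i | i <;> rcases j with j | j <;> rfl
  rw [hswap, det_fromBlocks_zero₁₂] at hperm
  have hs : IsUnit (((Equiv.Perm.sign (Equiv.sumComm m m) : ℤˣ) : ℤ) : R) :=
    (Units.isUnit _).map (Int.castRingHom R)
  have hu : IsUnit (Q.det * P.det) := by
    rw [hperm]
    exact hs.mul h
  exact IsUnit.mul_iff.mp hu

/-- The determinant of a block-upper-triangular matrix with invertible determinant has invertible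
diagonal blocks (`det (A B; 0 D) = det A · det D`). [folklore] -/
theorem isUnit_det_blocks_of_fromBlocks_zero₂₁ {A B D : Matrix m m R}
    (h : IsUnit (fromBlocks A B (0 : Matrix m m R) D).det) : IsUnit A.det ∧ IsUnit D.det := by
  rw [det_fromBlocks_zero₂₁] at h
  exact IsUnit.mul_iff.mp h

end BlockAlgebra

/-! ## `4 × 4` matrices cut at `2` -/

section FinFour

variable {R : Type*} [CommRing R]

/-- Transport of a relation `Nᵀ J N = ν • J` along a reindexing of rows and columns by the same
equivalence. [folklore] -/
theorem submatrix_transpose_mul_mul {n o : Type*} [Fintype n] [Fintype o] (e : o ≃ n)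
    (N J : Matrix n n R) :
    (N.submatrix e e)ᵀ * J.submatrix e e * N.submatrix e e = (Nᵀ * J * N).submatrix e e := by
  rw [transpose_submatrix, submatrix_mul_equiv, submatrix_mul_equiv]

variable {L : Type*} [Field L]

/-- **Ordinary symplectic `4 × 4` representations: isotropy of the sub and the shape of the
quotient block.**  Let `N : G → M₄(L)` and `ν : G → L` satisfy `N(τ)ᵀ J N(τ) = ν(τ) J` for an
invertible `J`, with every `N(τ)` invertible and block upper-triangular for the cut at `2`
(`N(τ)_{ij} = 0` for `i ≥ 2 > j`), and suppose some `τ₀` with `ν(τ₀) ≠ 1` acts as the identity on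
the sub-block (`N(τ₀)_{ij} = δ_{ij}`, `i, j < 2`).  Then (i) `J` vanishes on the sub-block
(`J_{ij} = 0`, `i, j < 2`: the sub is Lagrangian), and (ii) with `Q` the (invertible) upper-right
block of `J`, for EVERY `τ` the lower-right block of `N(τ)` is `ν(τ) · Q⁻¹ (upper-left block)⁻ᵀ Q`
— the quotient is the `ν`-twist of the contragredient of the sub, conjugated by a matrix
independent of `τ`.  (BCGP Cor. 9.3.5 / Def. 1.8.8: "ordinary, so an extension of an unramified
`V̄` by its Cartier dual".) [cite: BoxerCalegariGeePilloni2025, Cor. 9.3.5 and Def. 1.8.8] -/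
theorem quotientBlock_eq_of_symplectic_blockUpperTriangular {G : Type*}
    (N : G → Matrix (Fin 4) (Fin 4) L) (ν : G → L) (J : Matrix (Fin 4) (Fin 4) L)
    (hJ : IsUnit J.det) (hsymp : ∀ τ, (N τ)ᵀ * J * N τ = ν τ • J)
    (hinv : ∀ τ, IsUnit (N τ).det)
    (htri : ∀ (τ : G) (i j : Fin 4), 2 ≤ (i : ℕ) → (j : ℕ) < 2 → N τ i j = 0)
    (hfix : ∃ τ₀, ν τ₀ ≠ 1 ∧
      ∀ i j : Fin 4, (i : ℕ) < 2 → (j : ℕ) < 2 → N τ₀ i j = if i = j then 1 else 0) :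
    (∀ i j : Fin 4, (i : ℕ) < 2 → (j : ℕ) < 2 → J i j = 0) ∧
    ∃ Q : Matrix (Fin 2) (Fin 2) L, IsUnit Q.det ∧
      (∀ i j : Fin 2, Q i j = J (Fin.castAdd 2 i) (Fin.natAdd 2 j)) ∧
      ∀ τ, (N τ).submatrix (Fin.natAdd 2) (Fin.natAdd 2) =
        ν τ • (Q⁻¹ * ((N τ).submatrix (Fin.castAdd 2) (Fin.castAdd 2))⁻¹ᵀ * Q) := by
  -- notation for the blocks
  set e : Fin 2 ⊕ Fin 2 ≃ Fin 4 := finSumFinEquiv with he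
  have hN : ∀ τ, (N τ).submatrix e e =
      fromBlocks ((N τ).submatrix (Fin.castAdd 2) (Fin.castAdd 2))
        ((N τ).submatrix (Fin.castAdd 2) (Fin.natAdd 2 : Fin 2 → Fin 4)) 0
        ((N τ).submatrix (Fin.natAdd 2 : Fin 2 → Fin 4) (Fin.natAdd 2)) := fun τ ↦ by
    ext (i | i) (j | j)
    · rfl
    · rfl
    · change N τ (Fin.natAdd 2 i) (Fin.castAdd 2 j) = 0
      exact htri τ _ _ (Nat.le_add_right 2 i) j.isLt
    · rfl
  have hJblocks : J.submatrix e e =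
      fromBlocks (J.submatrix (Fin.castAdd 2) (Fin.castAdd 2))
        (J.submatrix (Fin.castAdd 2) (Fin.natAdd 2 : Fin 2 → Fin 4))
        (J.submatrix (Fin.natAdd 2 : Fin 2 → Fin 4) (Fin.castAdd 2))
        (J.submatrix (Fin.natAdd 2 : Fin 2 → Fin 4) (Fin.natAdd 2)) := by
    ext (i | i) (j | j) <;> rfl
  have hsymp' : ∀ τ, ((N τ).submatrix e e)ᵀ * J.submatrix e e * (N τ).submatrix e e =
      ν τ • J.submatrix e e := fun τ ↦ by
    rw [submatrix_transpose_mul_mul, hsymp τ, submatrix_smul]; rfl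
  -- (i) isotropy of the sub, from the element `τ₀`
  obtain ⟨τ₀, hν₀, hfix₀⟩ := hfix
  have hA₀ : (N τ₀).submatrix (Fin.castAdd 2) (Fin.castAdd 2) = (1 : Matrix (Fin 2) (Fin 2) L) := by
    ext i j
    rw [submatrix_apply, hfix₀ _ _ i.isLt j.isLt, one_apply]
    simp only [(Fin.castAdd_injective 2 2).eq_iff]
  have hS : J.submatrix (Fin.castAdd 2) (Fin.castAdd 2) = 0 := by
    have h := hsymp' τ₀
    rw [hN τ₀, hA₀, hJblocks] at h
    exact fromBlocks_topLeft_eq_zero_of_fixed hν₀ h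
  have hiso : ∀ i j : Fin 4, (i : ℕ) < 2 → (j : ℕ) < 2 → J i j = 0 := by
    intro i j hi hj
    have h := congrFun (congrFun hS ⟨i, hi⟩) ⟨j, hj⟩
    rw [submatrix_apply, Matrix.zero_apply] at h
    exact h
  -- (ii) the quotient block
  set Q : Matrix (Fin 2) (Fin 2) L := J.submatrix (Fin.castAdd 2) (Fin.natAdd 2 : Fin 2 → Fin 4)
    with hQ
  have hJ' : J.submatrix e e =
      fromBlocks 0 Q (J.submatrix (Fin.natAdd 2 : Fin 2 → Fin 4) (Fin.castAdd 2))
        (J.submatrix (Fin.natAdd 2 : Fin 2 → Fin 4) (Fin.natAdd 2)) := by rw [hJblocks, hS]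
  have hQunit : IsUnit Q.det := by
    have hdet : IsUnit (J.submatrix e e).det := by rwa [det_submatrix_equiv_self]
    rw [hJ'] at hdet
    exact (isUnit_det_blocks_of_fromBlocks_zero₁₁ hdet).1
  refine ⟨hiso, Q, hQunit, fun i j ↦ rfl, fun τ ↦ ?_⟩
  have h := hsymp' τ
  rw [hN τ, hJ'] at h
  have hAunit : IsUnit ((N τ).submatrix (Fin.castAdd 2) (Fin.castAdd 2)).det := by
    have hdet : IsUnit ((N τ).submatrix e e).det := by rw [det_submatrix_equiv_self]; exact hinv τ
    rw [hN τ] at hdet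
    exact (isUnit_det_blocks_of_fromBlocks_zero₂₁ hdet).1
  exact lowerRight_eq_smul_conj_of_symplectic_blockTriangular hAunit hQunit h

end FinFour

/-! ## Framed Galois representations: the hypothesis shape of `bcgp_switch_exists_modular_abelianSurface` -/

section Framed

variable {L : Type v} [Field L]

/-- Conjugating a symplectic framed representation: if `ρ(σ)ᵀ J ρ(σ) = ν(σ) J` for all `σ` then
`N(σ) := g ρ(σ) g⁻¹` satisfies `N(σ)ᵀ J_g N(σ) = ν(σ) J_g` for the transported Gram matrix
`J_g := (g⁻¹)ᵀ J g⁻¹`. [folklore] -/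
theorem transpose_conj_mul_mul_conj {n : ℕ} (ρg : GL (Fin n) L) (g : GL (Fin n) L)
    (J : Matrix (Fin n) (Fin n) L) (c : L) (h : ρg.valᵀ * J * ρg.val = c • J) :
    (g * ρg * g⁻¹).valᵀ * ((g⁻¹).valᵀ * J * (g⁻¹).val) * (g * ρg * g⁻¹).val =
      c • ((g⁻¹).valᵀ * J * (g⁻¹).val) := by
  have hgg : (g⁻¹).val * g.val = 1 := by rw [← Units.val_mul, inv_mul_cancel, Units.val_one]
  have hggt : g.valᵀ * (g⁻¹).valᵀ = 1 := by rw [← transpose_mul, hgg, transpose_one]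
  simp only [Units.val_mul, transpose_mul]
  calc (g⁻¹).valᵀ * (ρg.valᵀ * g.valᵀ) * ((g⁻¹).valᵀ * J * (g⁻¹).val) *
        (g.val * ρg.val * (g⁻¹).val)
      = (g⁻¹).valᵀ * ρg.valᵀ * (g.valᵀ * (g⁻¹).valᵀ) * J * ((g⁻¹).val * g.val) *
          ρg.val * (g⁻¹).val := by simp only [Matrix.mul_assoc]
    _ = (g⁻¹).valᵀ * (ρg.valᵀ * J * ρg.val) * (g⁻¹).val := by
          rw [hggt, hgg, Matrix.mul_one, Matrix.mul_one]; simp only [Matrix.mul_assoc]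
    _ = c • ((g⁻¹).valᵀ * J * (g⁻¹).val) := by
          rw [h, Matrix.mul_smul, Matrix.smul_mul, Matrix.mul_assoc]

variable {K : Type u} [Field K] [NumberField K] [TopologicalSpace L]

/-- **The hypothesis at `p` of `bcgp_switch_exists_modular_abelianSurface` / `IsOrdinaryFlatAt`
says "`ρ̄|_{Γ_{K_v}}` is an extension of `ν ⊗ W^∨` by an unramified `W`"** (BCGP Cor. 9.3.5,
Def. 1.8.8: "`ρ̄^∨` is ordinary, so an extension of an unramified `V̄` by its Cartier dual",
`V̄ = W^∨`, `ν = ε̄⁻¹`).  Precisely: let `ρ : Γ_K →ₜ* GL₄(L)` be symplectic with multiplier `ν`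
(`IsSymplecticWithMultiplierFun`), `v` a finite place, `g ∈ GL₄(L)` a frame in which every
`g ρ|_{Γ_{K_v}}(τ) g⁻¹` is block upper-triangular for the cut at `2` and inertia `I_{K_v}` acts as
the identity on the sub-block, and assume `ν ≠ 1` somewhere on (the image of) `I_{K_v}`.  Then
there is an invertible `Q ∈ M₂(L)` — the upper-right block of the transported Gram matrix
`(g⁻¹)ᵀ J g⁻¹`, which moreover VANISHES on the sub-block (the sub is Lagrangian) — such that for
every `τ ∈ Γ_{K_v}` the quotient block of `g ρ(τ) g⁻¹` equals
`ν(τ) · Q⁻¹ (sub block of g ρ(τ) g⁻¹)⁻ᵀ Q`.  From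
`quotientBlock_eq_of_symplectic_blockUpperTriangular`. [cite: BoxerCalegariGeePilloni2025, Cor. 9.3.5 and Def. 1.8.8] -/
theorem FramedGaloisRep.IsSymplecticWithMultiplierFun.quotientBlock_toLocal_eq_smul_conj
    {ρ : FramedGaloisRep K L 4} {ν : absoluteGaloisGroup K → L}
    (hρ : ρ.IsSymplecticWithMultiplierFun ν) (v : HeightOneSpectrum (𝓞 K)) (g : GL (Fin 4) L)
    (htri : ∀ (τ : absoluteGaloisGroup (v.adicCompletion K)) (i j : Fin 4),
      2 ≤ (i : ℕ) → (j : ℕ) < 2 → (g * ρ.toLocal v τ * g⁻¹).val i j = 0)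
    (hsub : ∀ τ ∈ absInertia (v.adicCompletion K), ∀ i j : Fin 4, (i : ℕ) < 2 → (j : ℕ) < 2 →
      (g * ρ.toLocal v τ * g⁻¹).val i j = if i = j then 1 else 0)
    (hν : ∃ τ ∈ absInertia (v.adicCompletion K),
      ν (absGaloisRestrict K (v.adicCompletion K) τ) ≠ 1) :
    ∃ (J : Matrix (Fin 4) (Fin 4) L) (Q : Matrix (Fin 2) (Fin 2) L),
      Jᵀ = -J ∧ IsUnit J.det ∧
      (∀ σ : absoluteGaloisGroup K, (ρ σ).valᵀ * J * (ρ σ).val = ν σ • J) ∧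
      (∀ i j : Fin 4, (i : ℕ) < 2 → (j : ℕ) < 2 → ((g⁻¹).valᵀ * J * (g⁻¹).val) i j = 0) ∧
      IsUnit Q.det ∧
      (∀ i j : Fin 2, Q i j = ((g⁻¹).valᵀ * J * (g⁻¹).val) (Fin.castAdd 2 i) (Fin.natAdd 2 j)) ∧
      ∀ τ : absoluteGaloisGroup (v.adicCompletion K),
        (g * ρ.toLocal v τ * g⁻¹).val.submatrix (Fin.natAdd 2) (Fin.natAdd 2) =
          ν (absGaloisRestrict K (v.adicCompletion K) τ) •
            (Q⁻¹ * ((g * ρ.toLocal v τ * g⁻¹).val.submatrix (Fin.castAdd 2) (Fin.castAdd 2))⁻¹ᵀ * Q) := by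
  obtain ⟨J, hJT, hJ, hJρ⟩ := hρ
  set Jg : Matrix (Fin 4) (Fin 4) L := (g⁻¹).valᵀ * J * (g⁻¹).val with hJg
  have hJgunit : IsUnit Jg.det := by
    rw [hJg, det_mul, det_mul, det_transpose]
    have hg : IsUnit (g⁻¹).val.det := (Matrix.isUnit_iff_isUnit_det _).mp (Units.isUnit _)
    exact (hg.mul hJ).mul hg
  have hsymp : ∀ τ : absoluteGaloisGroup (v.adicCompletion K),
      (g * ρ.toLocal v τ * g⁻¹).valᵀ * Jg * (g * ρ.toLocal v τ * g⁻¹).val =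
        ν (absGaloisRestrict K (v.adicCompletion K) τ) • Jg := fun τ ↦ by
    rw [hJg, FramedGaloisRep.toLocal_apply]
    exact transpose_conj_mul_mul_conj _ g J _ (hJρ _)
  have hinv : ∀ τ : absoluteGaloisGroup (v.adicCompletion K),
      IsUnit (g * ρ.toLocal v τ * g⁻¹).val.det := fun τ ↦
    (Matrix.isUnit_iff_isUnit_det _).mp (Units.isUnit _)
  obtain ⟨τ₀, hτ₀, hν₀⟩ := hν
  obtain ⟨hiso, Q, hQ, hQJ, hquot⟩ :=
    quotientBlock_eq_of_symplectic_blockUpperTriangular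
      (fun τ ↦ (g * ρ.toLocal v τ * g⁻¹).val)
      (fun τ ↦ ν (absGaloisRestrict K (v.adicCompletion K) τ)) Jg hJgunit hsymp hinv htri
      ⟨τ₀, hν₀, hsub τ₀ hτ₀⟩
  exact ⟨J, Q, hJT, hJ, hJρ, hiso, hQ, hQJ, hquot⟩

end Framed

end Literature.NumberTheory.GaloisRepresentations
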